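/-
Copyright (c) 2026 the pub-hodgecm-mathlib formalisation cell (harness21).  Prover seat hodgecm-mathlib-LH7-p09 (g2), CLOSE-OUT ROSTER strike line L3∕L5 (Track A
«(D-RAM) FOUR-FRAME» squad F0∕P3c∕LH4 ∕ F0∕P3c∕LH7); β₂-BOARD v2 row (OFF) (lead LH7-p09 (g2); assembler LH4-p12 (g8) ED. 4 `…OffRowOfPiecesParity`, socket `hL`);
helper lane on h413 = stmt-HodgeConjecture-24833 (count-neutral).  2026-09-05.
-/
import Summits.HodgeConjecture.HodgeConjecture.Theorems.F0P3cDyRamLowerLineOnShell        -- ★ (this seat, FILE 7): `latticeNearTransvShell_of_line` per glued vertex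
import Summits.HodgeConjecture.HodgeConjecture.Theorems.F0P3cDyRamConeCellPresentation    -- ★ p862869 (this seat): the junction `exists_presentation_of_mem_levelSetDep`
import HarnessLib

/-!
# Crux `H413`, line LH4 «(D-RAM) FOUR-FRAME» — the (β₂) road (R-36), β₂-BOARD v2 row (OFF), socket `hL`: «ON THE LOWER LINE THE SHELL CONJUNCT DROPS OUT OF BOTH
# LITERALS» — the per-cell fold of ★ FILE 7 through ★ p862869's junction

Cell `hodgecm-mathlib` (D-0151), FLOOR 0, crux item H413 = `stmt-HodgeConjecture-24833`, route of record `HCCMUnconditional`; squads F0∕P3c∕LH4 ∕ LH7; lane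
`--supports stmt-HodgeConjecture-24833 --as helper` (count-neutral; pays NO tier-0 row).  THEOREMS ONLY (no `def`, no instance, no notation, no `sorry`, default heartbeats);
★-only imports; states NO law; (β₂) stays a HYPOTHESIS.  DATUM-FREE: ★ p861044∕p861305's block frame (plane `(E², H₂)`, `σ` an isometric involution, `H₂` hermitian with
unit determinant, `|h_W| = 1`, `|ϖ| = exp(−1)`), the line model `(M, jE, ρ, Θ, α; φ, lam, h)` of ★ (C1), ★ DEFS `levelSetDep`, exactly as in ★ p862869.

WHY.  In LH4-p12 (g8)'s (OFF) assembly ED. 4 `cellDiff_offRow_eq_zero_of_pieces₄` the socket `hL` (lower line `j + b + d % 2 = jl`, `2b + d % 2 < m`, `1 ≤ b < j`) is the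
difference of two finsums over `levelSetDep(j, b; μ) ∩ {Λ | ∃ B, φ(B) = Λ ∧ ∃ L₃, SD ∧ L₃ ∩ W = ι_W B ∧ tube_b ∧ (LatticeNearTransvShell ϖ (d % 2) M (Γ − 1) L₃ ∧ label)}` with
`M = m*` (label `+`) resp. `M = m_c` (label `−′`).  ★ FILE 7 `latticeNearTransvShell_of_line` puts EVERY glued vertex over a lower-line cell member on the shell `(ℓ₀, M)` for
every `M = ℓ₀ + k` with `|μ| ≤ |ϖE|^k`, `|u₀₀ − 1| ≤ |ϖ^{m′}|`, `k, ℓ₀ ≤ m′`; ★ p862869 supplies the glued-vertex letters of any `(B, L₃)` in the set.  Hence: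
* §1 `latticeNearTransvShell_of_mem_levelSetDep_of_line` — POINTWISE: for `Λ ∈ levelSetDep(j, b; μ)` on the lower line and any glued `(B, L₃)` over it,
  `LatticeNearTransvShell ϖ ℓ₀ M (Γ − 1) L₃`.
* §2 HEAD `levelSetDep_inter_shell_and_eq_of_line` — THE FOLD: for every trailing predicate `P`, the subset cut out by `(… ∧ (LatticeNearTransvShell ϖ ℓ₀ M (Γ − 1) L₃ ∧ P L₃))`
  EQUALS the subset cut out by `(… ∧ P L₃)` — at `P := (VS_{m*} = V₊)`, `M := m*` and at `P := ¬(VS_{m*} = V₊)`, `M := m_c` the two literals of `hL` lose their shell conjuncts, and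
  `hL` becomes the pure LABEL balance «`Σ_{Λ : VS = V₊} f = Σ_{Λ : VS ≠ V₊} f`» on the lower line.
LETTERS of the line, in the cell's currency (`cc = ϖE^j`): `hμ : |μ| ≤ |ϖE|^{2b+ℓ₀+1}` (below the row), `hanti : |μ − ρμ| = |ϖE^j·(α − ρα)|·|ϖE|^{b+ℓ₀}` (the line; from `_hjl`,
`|α − ρα| = 1`, `j + b + ℓ₀ = jl`), `hμk : |μ| ≤ |ϖE|^k`, `hum : |u₀₀ − 1| ≤ |ϖ^{m′}|` with `ℓ₀ ≤ m′`, `k ≤ m′` (from the fence `N₀ ≥ m_c`), `hmk : ℓ₀ + k = M`.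
HONEST LABEL.  Count-neutral lattice bookkeeping; nothing printed is asserted; no census law is stated; the balance itself (`hL`) stays OPEN; `HC_CM` is proved only modulo the 7
printed citations (2 remaining named inputs: hLiu418 = `stmt-HodgeConjecture-24832`, h413 = `stmt-HodgeConjecture-24833`) until rung 0 closes.
## References
* [Jacobowitz1962] R. Jacobowitz, *Hermitian forms over local fields*, Amer. J. Math. 84 (1962): §4 (duals, modular components, gluing).
* [BruhatTits1972] F. Bruhat, J. Tits, *Groupes réductifs sur un corps local I*, Publ. Math. IHÉS 41 (1972): §10.
* [Kottwitz1986BaseChangeUnits] R. E. Kottwitz, *Base change for unit elements of Hecke algebras*, Compositio Math. 60 (1986): §1 pp. 240–241, §3.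
* [Rogawski1990] J. D. Rogawski, *Automorphic Representations of Unitary Groups in Three Variables*, Ann. of Math. Stud. 123 (1990): §4.9 Prop. 4.9.1 (b) p. 55.
-/

set_option autoImplicit false

noncomputable section

namespace Summit.HodgeConjecture.HodgeConjecture.Cruxes.H413.F0P3cDyRamLowerLineShellFold

open scoped Valued WithZero Matrix MatrixGroups
open WithZero
open Literature.NumberTheory.Automorphic Literature.NumberTheory.Automorphic.HermitianLattice Literature.NumberTheory.Automorphic.UnitaryLatticeTree
open Literature.NumberTheory.Automorphic.EllipticPlaneAsFieldLine
open Literature.NumberTheory.Rogawski1990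
open Summit.HodgeConjecture.HodgeConjecture.Cruxes.H413.F0P3cDyRamToricCensusDefs
open Summit.HodgeConjecture.HodgeConjecture.Cruxes.H413.F0P3cDyRamFourFrameCensusDefs (LatticeInLevel LatticeNearTransvShell)
open Summit.HodgeConjecture.HodgeConjecture.Cruxes.H413.F0P3cDyRamBoundaryCellLetterCardTwo (v_map_lt_one_iff_of_le_iff)
open Summit.HodgeConjecture.HodgeConjecture.Cruxes.H413.F0P3cDyRamConeCellPresentation (exists_presentation_of_mem_levelSetDep)
open Summit.HodgeConjecture.HodgeConjecture.Cruxes.H413.F0P3cDyRamLowerLineOnShell (latticeNearTransvShell_of_line)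

variable {E M : Type} [Field E] [Valued E ℤᵐ⁰] [Field M] [Valued M ℤᵐ⁰] {ρ Θ : M →+* M} {α : M}

/-! ## §1 Pointwise: every glued vertex over a lower-line cell member is on the shell `(ℓ₀, M)` -/

/-- **EVERY GLUED VERTEX OVER A LOWER-LINE CELL MEMBER IS ON THE SHELL `(ℓ₀, M)`.**  Block frame + line model (★ (C1) letters, `|jE c| ≤ 1 ↔ |c| ≤ 1`, `Fix ρ = jE(E)`), literal
`(γ₂, u)` with `|u₀₀ − 1| ≤ |ϖ^{m′}|`, `ℓ₀ ≤ m′`, `k ≤ m′`, `ℓ₀ + k = M`; cone cell `(j, b)` with `1 ≤ b < j`, `lam ∈ 𝒪_j`; LOWER-LINE letters on `μ = lam − jE u₀₀`: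
`|μ| ≤ |ϖE|^{2b+ℓ₀+1}`, `|μ| ≤ |ϖE|^k`, `|μ − ρμ| = |ϖE^j(α − ρα)|·|ϖE|^{b+ℓ₀}`.  THEN for `Λ ∈ levelSetDep(j, b; μ)`, `φ(B) = Λ`, `L₃` self-dual with `L₃ ∩ W = ι_W B` and tube `b`:
`LatticeNearTransvShell ϖ ℓ₀ M (Γ − 1) L₃` (★ FILE 7 per vertex, ★ p862869 the letters).
[cite: Kottwitz1986BaseChangeUnits, §1 pp. 240–241; §3] [cite: Jacobowitz1962, §4] [cite: Rogawski1990, §4.9 Prop. 4.9.1 (b) p. 55] -/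
theorem latticeNearTransvShell_of_mem_levelSetDep_of_line
    (σ : E →+* E) (hσ : ∀ a, σ (σ a) = a) (hvσ : ∀ a, Valued.v (σ a) = Valued.v a) {ϖ : E} (hϖ : Valued.v ϖ = exp (-1 : ℤ))
    {H₂ : Matrix (Fin 2) (Fin 2) E} (hH₂ : IsUnit H₂.det) (hH₂σ : (H₂.map σ)ᵀ = H₂) {hW : E} (hhW : Valued.v hW = 1)
    (jE : E →+* M) (hρρ : ∀ x, ρ (ρ x) = x) (hvρ : ∀ x, Valued.v (ρ x) = Valued.v x) (hα : ρ α ≠ α) (hα1 : Valued.v α ≤ 1)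
    (hint : ∀ z : M, Valued.v z ≤ 1 → Valued.v ((z - ρ z) / (α - ρ α)) ≤ 1)
    (hΘΘ : ∀ x, Θ (Θ x) = x) (hΘρ : ∀ x, Θ (ρ x) = ρ (Θ x)) (hvΘ : ∀ x, Valued.v (Θ x) = Valued.v x)
    (hjv : ∀ c, Valued.v (jE c) ≤ 1 ↔ Valued.v c ≤ 1) (hjfix : ∀ z, ρ z = z ↔ ∃ c, jE c = z)
    (hjpow : ∀ (t : E) (n : ℤ), Valued.v (jE t) = Valued.v (jE ϖ) ^ n ↔ Valued.v t = Valued.v ϖ ^ n)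
    (hϖmax : ∀ t : M, ρ t = t → Valued.v t < 1 → Valued.v t ≤ Valued.v (jE ϖ))
    (φ : (Fin 2 → E) →+ M) (hφs : ∀ (c : E) (x : Fin 2 → E), φ (c • x) = jE c * φ x) (hφi : Function.Injective φ) (hφo : Function.Surjective φ)
    {γ₂ : GL (Fin 2) E} {lam h : M} (hφγ : ∀ x, φ ((γ₂ : Matrix (Fin 2) (Fin 2) E).mulVec x) = lam * φ x) (hlam : Valued.v lam = 1)
    (hΘh : Θ h = h) (hh : h ≠ 0) (hform : ∀ x y, jE (pairing σ H₂ x y) = h * Θ (φ x) * φ y + ρ (h * Θ (φ x) * φ y))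
    (u : GL (Fin 1) E) (ℓ₀ k mt : ℕ) (hmk : ℓ₀ + k = mt) {m' : ℕ} (hLm : ℓ₀ ≤ m') (hkm : k ≤ m')
    (hum : Valued.v ((u : Matrix (Fin 1) (Fin 1) E) 0 0 - 1) ≤ Valued.v (ϖ ^ m'))
    {b j : ℕ} (hb1 : 1 ≤ b) (hbj : b < j) (hlamj : IsOrd ρ α (jE ϖ ^ j) lam)
    (hμk : Valued.v (lam - jE ((u : Matrix (Fin 1) (Fin 1) E) 0 0)) ≤ Valued.v (jE ϖ) ^ k)
    (hμ : Valued.v (lam - jE ((u : Matrix (Fin 1) (Fin 1) E) 0 0)) ≤ Valued.v (jE ϖ) ^ (2 * b + ℓ₀ + 1))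
    (hanti : Valued.v ((lam - jE ((u : Matrix (Fin 1) (Fin 1) E) 0 0)) - ρ (lam - jE ((u : Matrix (Fin 1) (Fin 1) E) 0 0))) =
      Valued.v (jE ϖ ^ j * (α - ρ α)) * Valued.v (jE ϖ) ^ (b + ℓ₀))
    {Λ : AddSubgroup M} (hΛ : Λ ∈ levelSetDep ρ Θ α (jE ϖ) h j b (lam - jE ((u : Matrix (Fin 1) (Fin 1) E) 0 0)))
    {B : Submodule 𝒪[E] (Fin 2 → E)} (hBΛ : B.toAddSubgroup.map φ = Λ)
    {L₃ : Submodule 𝒪[E] (Fin 3 → E)} (hL : IsSelfDualLattice σ ϖ (!![H₂ 0 0, 0, H₂ 0 1; 0, hW, 0; H₂ 1 0, 0, H₂ 1 1] : Matrix (Fin 3) (Fin 3) E) L₃)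
    (hLB : L₃ ⊓ LinearMap.ker ((LinearMap.proj (1 : Fin 3) : (Fin 3 → E) →ₗ[E] E).restrictScalars 𝒪[E]) =
      B.map ((Matrix.toLin' (!![1, 0; 0, 0; 0, 1] : Matrix (Fin 3) (Fin 2) E)).restrictScalars 𝒪[E]))
    (htube : ∀ c : E, (Pi.single 1 c : Fin 3 → E) ∈ L₃ ↔ Valued.v c ≤ Valued.v ϖ ^ b) :
    LatticeNearTransvShell ϖ ℓ₀ mt ((((endoGL (γ₂, u) : GL (Fin 3) E) : Matrix (Fin 3) (Fin 3) E) - 1)) L₃ := by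
  have hvϖ0 : Valued.v ϖ ≠ 0 := by rw [hϖ]; exact exp_ne_zero
  have hϖ0 : ϖ ≠ 0 := fun h0 => hvϖ0 (by rw [h0, map_zero])
  have hϖlt : Valued.v ϖ < 1 := by rw [hϖ, ← exp_zero, exp_lt_exp]; norm_num
  have hjϖ0 : jE ϖ ≠ 0 := (map_ne_zero jE).2 hϖ0
  have hjϖlt : Valued.v (jE ϖ) < 1 := (v_map_lt_one_iff_of_le_iff jE hjv ϖ).2 hϖlt
  have hc0 : jE ϖ ^ j ≠ 0 := pow_ne_zero j hjϖ0
  have hcb : Valued.v (jE ϖ ^ j) < Valued.v (jE ϖ) ^ b := by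
    rw [Valuation.map_pow]; exact pow_lt_pow_right_of_lt_one₀ (zero_lt_iff.2 ((Valuation.ne_zero_iff _).2 hjϖ0)) hjϖlt hbj
  obtain ⟨x₀, w₀, g₀, hx₀, hΛx, hyO, -, hylev, hw₀Y, hpr, hg₀, hg₀1, hprg⟩ :=
    exists_presentation_of_mem_levelSetDep σ hσ hvσ hϖ hH₂ hH₂σ hhW jE hρρ hvρ hα hα1 hint hΘΘ hΘρ hvΘ hjv hjfix hjpow hϖmax φ hφs hφi hφo hφγ hlam hΘh hh hform
      ((u : Matrix (Fin 1) (Fin 1) E) 0 0) hb1 hlamj hΛ hBΛ hL hLB htube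
  exact latticeNearTransvShell_of_line hvρ hα hα1 hϖ jE hjv hjfix φ hφs hφi hφγ htube hpr hLB.symm hg₀ hg₀1 hprg hBΛ hc0 hx₀ hΛx hw₀Y hyO hylev hcb u ℓ₀ k mt hmk
    hLm hkm hum hμk hμ hanti

/-! ## §2 THE FOLD: on the lower line the shell conjunct drops out of the cell's labelled subsets -/

/-- **FOLD — «ON THE LOWER LINE THE SHELL CONJUNCT DROPS OUT».**  Same frame and letters as §1 (quantified over the cell).  THEN for every trailing predicate `P` on `L₃`, the
subset of `levelSetDep(j, b; μ)` cut out by `∃ B, φ(B) = Λ ∧ ∃ L₃, SD ∧ L₃ ∩ W = ι_W B ∧ tube_b ∧ (LatticeNearTransvShell ϖ ℓ₀ M (Γ − 1) L₃ ∧ P L₃)` EQUALS the subset cut out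
by `∃ B, φ(B) = Λ ∧ ∃ L₃, SD ∧ L₃ ∩ W = ι_W B ∧ tube_b ∧ P L₃` — both literals of the (OFF) socket `hL` (`P :=` the value-set clause resp. its negation, `M := m*` resp. `m_c`).
[cite: Kottwitz1986BaseChangeUnits, §1 pp. 240–241; §3] [cite: Jacobowitz1962, §4] [cite: Rogawski1990, §4.9 Prop. 4.9.1 (b) p. 55] -/
theorem levelSetDep_inter_shell_and_eq_of_line
    (σ : E →+* E) (hσ : ∀ a, σ (σ a) = a) (hvσ : ∀ a, Valued.v (σ a) = Valued.v a) {ϖ : E} (hϖ : Valued.v ϖ = exp (-1 : ℤ))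
    {H₂ : Matrix (Fin 2) (Fin 2) E} (hH₂ : IsUnit H₂.det) (hH₂σ : (H₂.map σ)ᵀ = H₂) {hW : E} (hhW : Valued.v hW = 1)
    (jE : E →+* M) (hρρ : ∀ x, ρ (ρ x) = x) (hvρ : ∀ x, Valued.v (ρ x) = Valued.v x) (hα : ρ α ≠ α) (hα1 : Valued.v α ≤ 1)
    (hint : ∀ z : M, Valued.v z ≤ 1 → Valued.v ((z - ρ z) / (α - ρ α)) ≤ 1)
    (hΘΘ : ∀ x, Θ (Θ x) = x) (hΘρ : ∀ x, Θ (ρ x) = ρ (Θ x)) (hvΘ : ∀ x, Valued.v (Θ x) = Valued.v x)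
    (hjv : ∀ c, Valued.v (jE c) ≤ 1 ↔ Valued.v c ≤ 1) (hjfix : ∀ z, ρ z = z ↔ ∃ c, jE c = z)
    (hjpow : ∀ (t : E) (n : ℤ), Valued.v (jE t) = Valued.v (jE ϖ) ^ n ↔ Valued.v t = Valued.v ϖ ^ n)
    (hϖmax : ∀ t : M, ρ t = t → Valued.v t < 1 → Valued.v t ≤ Valued.v (jE ϖ))
    (φ : (Fin 2 → E) →+ M) (hφs : ∀ (c : E) (x : Fin 2 → E), φ (c • x) = jE c * φ x) (hφi : Function.Injective φ) (hφo : Function.Surjective φ)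
    {γ₂ : GL (Fin 2) E} {lam h : M} (hφγ : ∀ x, φ ((γ₂ : Matrix (Fin 2) (Fin 2) E).mulVec x) = lam * φ x) (hlam : Valued.v lam = 1)
    (hΘh : Θ h = h) (hh : h ≠ 0) (hform : ∀ x y, jE (pairing σ H₂ x y) = h * Θ (φ x) * φ y + ρ (h * Θ (φ x) * φ y))
    (u : GL (Fin 1) E) (ℓ₀ k mt : ℕ) (hmk : ℓ₀ + k = mt) {m' : ℕ} (hLm : ℓ₀ ≤ m') (hkm : k ≤ m')
    (hum : Valued.v ((u : Matrix (Fin 1) (Fin 1) E) 0 0 - 1) ≤ Valued.v (ϖ ^ m'))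
    {b j : ℕ} (hb1 : 1 ≤ b) (hbj : b < j) (hlamj : IsOrd ρ α (jE ϖ ^ j) lam)
    (hμk : Valued.v (lam - jE ((u : Matrix (Fin 1) (Fin 1) E) 0 0)) ≤ Valued.v (jE ϖ) ^ k)
    (hμ : Valued.v (lam - jE ((u : Matrix (Fin 1) (Fin 1) E) 0 0)) ≤ Valued.v (jE ϖ) ^ (2 * b + ℓ₀ + 1))
    (hanti : Valued.v ((lam - jE ((u : Matrix (Fin 1) (Fin 1) E) 0 0)) - ρ (lam - jE ((u : Matrix (Fin 1) (Fin 1) E) 0 0))) =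
      Valued.v (jE ϖ ^ j * (α - ρ α)) * Valued.v (jE ϖ) ^ (b + ℓ₀))
    (P : Submodule 𝒪[E] (Fin 3 → E) → Prop) :
    levelSetDep ρ Θ α (jE ϖ) h j b (lam - jE ((u : Matrix (Fin 1) (Fin 1) E) 0 0)) ∩
        {Λ | ∃ B : Submodule 𝒪[E] (Fin 2 → E), B.toAddSubgroup.map φ = Λ ∧
          ∃ L₃ : Submodule 𝒪[E] (Fin 3 → E), IsSelfDualLattice σ ϖ (!![H₂ 0 0, 0, H₂ 0 1; 0, hW, 0; H₂ 1 0, 0, H₂ 1 1] : Matrix (Fin 3) (Fin 3) E) L₃ ∧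
            L₃ ⊓ LinearMap.ker ((LinearMap.proj (1 : Fin 3) : (Fin 3 → E) →ₗ[E] E).restrictScalars 𝒪[E]) =
              B.map ((Matrix.toLin' (!![1, 0; 0, 0; 0, 1] : Matrix (Fin 3) (Fin 2) E)).restrictScalars 𝒪[E]) ∧
            (∀ c : E, (Pi.single 1 c : Fin 3 → E) ∈ L₃ ↔ Valued.v c ≤ Valued.v ϖ ^ b) ∧
            (LatticeNearTransvShell ϖ ℓ₀ mt ((((endoGL (γ₂, u) : GL (Fin 3) E) : Matrix (Fin 3) (Fin 3) E) - 1)) L₃ ∧ P L₃)} =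
      levelSetDep ρ Θ α (jE ϖ) h j b (lam - jE ((u : Matrix (Fin 1) (Fin 1) E) 0 0)) ∩
        {Λ | ∃ B : Submodule 𝒪[E] (Fin 2 → E), B.toAddSubgroup.map φ = Λ ∧
          ∃ L₃ : Submodule 𝒪[E] (Fin 3 → E), IsSelfDualLattice σ ϖ (!![H₂ 0 0, 0, H₂ 0 1; 0, hW, 0; H₂ 1 0, 0, H₂ 1 1] : Matrix (Fin 3) (Fin 3) E) L₃ ∧
            L₃ ⊓ LinearMap.ker ((LinearMap.proj (1 : Fin 3) : (Fin 3 → E) →ₗ[E] E).restrictScalars 𝒪[E]) =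
              B.map ((Matrix.toLin' (!![1, 0; 0, 0; 0, 1] : Matrix (Fin 3) (Fin 2) E)).restrictScalars 𝒪[E]) ∧
            (∀ c : E, (Pi.single 1 c : Fin 3 → E) ∈ L₃ ↔ Valued.v c ≤ Valued.v ϖ ^ b) ∧ P L₃} := by
  ext Λ
  constructor
  · rintro ⟨hΛ, B, hBΛ, L₃, hL, hLB, htube, -, hP⟩
    exact ⟨hΛ, B, hBΛ, L₃, hL, hLB, htube, hP⟩
  · rintro ⟨hΛ, B, hBΛ, L₃, hL, hLB, htube, hP⟩
    exact ⟨hΛ, B, hBΛ, L₃, hL, hLB, htube,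
      latticeNearTransvShell_of_mem_levelSetDep_of_line σ hσ hvσ hϖ hH₂ hH₂σ hhW jE hρρ hvρ hα hα1 hint hΘΘ hΘρ hvΘ hjv hjfix hjpow hϖmax φ hφs hφi hφo hφγ hlam
        hΘh hh hform u ℓ₀ k mt hmk hLm hkm hum hb1 hbj hlamj hμk hμ hanti hΛ hBΛ hL hLB htube, hP⟩

end Summit.HodgeConjecture.HodgeConjecture.Cruxes.H413.F0P3cDyRamLowerLineShellFold

end
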